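import Literature.NumberTheory.Transcendental.KZProductIdeal
import Literature.NumberTheory.Transcendental.KZLogCalculusProofs
import Literature.NumberTheory.Transcendental.KZDominatedFamilyRelations
import Summits.KontsevichZagierPeriods.KontsevichZagierPeriods.Theorems.TerasomaMultiplicationBetaCancellationStubPiAsArctan

/-!
# `NormalFormPrinciple` (stmt-KontsevichZagierPeriods-3869), line `SketchIdeator1` —
# stub `stub_piCalibration`

**Calibration of `[π]`.** Inside the Kontsevich–Zagier calculus of moves, the disc
`[π] = [{x² + y² ≤ 1}, 1]` (`KZ.piRep`, value `π`) is congruent to TWICE the bounded arctangent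
kernel `κ = [[0,1], du/((1−u)² + u²)]` (value `∫₀¹ du/((1−u)²+u²) = arctan(2u−1)|₀¹ = π/2`):
`[π] − 2•[κ] ∈ KZ.relations`. The chain of moves (Kontsevich–Zagier 2001, §1.1–1.2):

* `[(-1,1), 2 dt/(1+t²)] ∼ [{x²+y² ≤ 1}, 1]` is the landed theorem `stub_piAsArctan` (KZ's §1.1
  example `π = ∬_{x²+y²≤1} dx dy = ∫_{-1}^{1} dx/√(1−x²)` plus one rational substitution);
* ONE change of variables (rule 2): the affine map `t ↦ u = (1+t)/2` of `(-1,1)` onto `(0,1)`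
  (`halfAffine`, Jacobian `1/2`) pulls `[(0,1), 2 du/((1−u)²+u²)]` back to
  `[(-1,1), 2 dt/(1+t²)]`, since `(1−u)² + u² = (1+t²)/2`;
* closed versus open interval (rule 1a): `[0,1] ∖ (0,1) = {0, 1}` is Lebesgue-null, so
  `[κ] ≡ [κ|_(0,1)]` (`KZ.IntegralRep.of_sub_of_restrict_mem_relations`);
* integrand additivity (rule 1b): `[(0,1), 2f] ≡ [(0,1), f] + [(0,1), f]`.

No definitions are introduced: the two auxiliary representations are anonymous structures.
-/

noncomputable section

open MeasureTheory Set
open Literature.NumberTheory.Transcendental Literature.NumberTheory.Transcendental.KZ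
open Literature.ModelTheory.ExponentialFields (IsSemialgebraic)

namespace Summit.KontsevichZagierPeriods.HurwitzMicroSectors.NormalFormPrinciple.PiBox

namespace stub_piCalibrationAux

open Literature.NumberTheory.Transcendental.KZreg (unitIoo isSemialgebraic_unitIoo)
open Summit.KontsevichZagierPeriods.KontsevichZagierPeriods.BetaCancellationNegative
  (symIoo mem_symIoo mem_unitIoo isSemialgebraic_symIoo integrableOn_symIoo_of_continuous
    halfAffine halfAffineDeriv hasFDerivAt_halfAffine abs_det_halfAffineDeriv injective_halfAffine
    image_halfAffine_symIoo isSemialgebraicMapOn_halfAffine volume_setOf_apply_eq_zero)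
open Summit.KontsevichZagierPeriods.KontsevichZagierPeriods.BetaCancellationLine (stub_piAsArctan)

/-- The pull-back identity of the affine substitution `u = (1+t)/2`, Jacobian `1/2` included:
`(f(u) + f(u)) · (1/2) = 2/(1+t²)` for `f(u) = 1/((1−u)²+u²)`. [folklore] -/
theorem pullback_halfAffine (t : ℝ) :
    (1 / ((1 - (1 + t) / 2) ^ 2 + ((1 + t) / 2) ^ 2) +
        1 / ((1 - (1 + t) / 2) ^ 2 + ((1 + t) / 2) ^ 2)) * (1 / 2) = 2 / (1 + t ^ 2) := by
  have h1 : (0:ℝ) < 1 + t ^ 2 := by positivity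
  have h2 : (1 - (1 + t) / 2) ^ 2 + ((1 + t) / 2) ^ 2 = (1 + t ^ 2) / 2 := by ring
  rw [h2]
  field_simp
  ring

/-- The arctangent representation `[(-1,1), 2 dt/(1+t²)]` exists. [folklore] -/
theorem exists_arctanRep :
    ∃ T : IntegralRep 1, T.domain = symIoo ∧ T.integrand = fun x => 2 / (1 + x 0 ^ 2) := by
  have hsa : IsSemialgebraicFunOn ℚ symIoo (fun x : Fin 1 → ℝ => 2 / (1 + x 0 ^ 2)) := by
    refine (isSemialgebraicFunOn_aeval_div_aeval isSemialgebraic_symIoo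
      (MvPolynomial.C 2 : MvPolynomial (Fin 1) ℚ) (1 + MvPolynomial.X 0 ^ 2) fun x _ => ?_).congr
      fun x _ => ?_
    · simp only [map_add, map_one, map_pow, MvPolynomial.aeval_X]
      positivity
    · simp only [map_add, map_one, map_pow, MvPolynomial.aeval_X, MvPolynomial.aeval_C,
        eq_ratCast, Rat.cast_ofNat]
  have hc : Continuous fun x : Fin 1 → ℝ => 2 / (1 + x 0 ^ 2) :=
    Continuous.div continuous_const (by fun_prop) fun x => by positivity
  exact ⟨⟨symIoo, fun x => 2 / (1 + x 0 ^ 2), isSemialgebraic_symIoo, hsa,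
    integrableOn_symIoo_of_continuous hc⟩, rfl, rfl⟩

/-- `[(-1,1), 2 dt/(1+t²)] ∼ [π]` (`stub_piAsArctan` with `P := piRep`).
[cite: KontsevichZagier2001, §1.1] -/
theorem arctanRep_equivalent_piRep (T : IntegralRep 1) (hTd : T.domain = symIoo)
    (hTi : T.integrand = fun x => 2 / (1 + x 0 ^ 2)) : Equivalent T piRep :=
  stub_piAsArctan T piRep (by rw [hTd]; rfl) (fun x _ => by rw [hTi]) rfl fun _ _ => rfl

/-- `[0,1] ∖ (0,1) ⊆ ℝ¹` is null (two points). [folklore] -/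
theorem volume_Icc_diff_unitIoo :
    volume ({x : Fin 1 → ℝ | x 0 ∈ Set.Icc (0:ℝ) 1} \ unitIoo) = 0 := by
  refine measure_mono_null (fun x hx => ?_)
    (measure_union_null (volume_setOf_apply_eq_zero (0 : Fin 1) 0)
      (volume_setOf_apply_eq_zero (0 : Fin 1) 1))
  simp only [mem_sdiff, mem_setOf_eq, mem_Icc, mem_unitIoo, mem_Ioo, not_and, not_lt] at hx
  simp only [mem_union, mem_setOf_eq]
  obtain ⟨⟨h1, h2⟩, h3⟩ := hx
  rcases h1.lt_or_eq with h1 | h1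
  · exact Or.inr (le_antisymm h2 (h3 h1))
  · exact Or.inl h1.symm

/-- The open kernel doubled, `[(0,1), f + f]` for a representation `[[0,1], f]`, together with
its two relations: `[(0,1), f+f] − [(0,1), f] − [(0,1), f] ∈ relations` (rule 1b) and
`[[0,1], f] − [(0,1), f] ∈ relations` (rule 1a, null boundary). [folklore] -/
theorem exists_double_open (κ : IntegralRep 1) (hd : κ.domain = {x | x 0 ∈ Set.Icc (0:ℝ) 1}) :
    ∃ κ₂ κ₀ : IntegralRep 1, κ₂.domain = unitIoo ∧ κ₂.integrand = κ.integrand + κ.integrand ∧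
      of κ₂ - of κ₀ - of κ₀ ∈ relations ∧ of κ - of κ₀ ∈ relations := by
  have hU : unitIoo ⊆ κ.domain := by
    rw [hd]
    intro x hx
    exact ⟨hx.1.le, hx.2.le⟩
  let κ₀ : IntegralRep 1 := κ.restrict unitIoo isSemialgebraic_unitIoo hU
  have h4 : of κ - of κ₀ ∈ relations :=
    κ.of_sub_of_restrict_mem_relations isSemialgebraic_unitIoo hU
      (by rw [hd]; exact volume_Icc_diff_unitIoo)
  let κ₂ : IntegralRep 1 :=
    { domain := unitIoo
      integrand := κ.integrand + κ.integrand
      isSemialgebraic_domain := isSemialgebraic_unitIoo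
      isSemialgebraicFunOn_integrand :=
        IsSemialgebraicFunOn.add_holds κ₀.isSemialgebraicFunOn_integrand
          κ₀.isSemialgebraicFunOn_integrand
      integrableOn := κ₀.integrableOn.add κ₀.integrableOn }
  refine ⟨κ₂, κ₀, rfl, rfl, ?_, h4⟩
  exact integrandAddRel_subset_relations ⟨1, κ₂, κ₀, κ₀, rfl, rfl, fun _ _ => rfl, rfl⟩

/-- **The affine move** (rule 2): for `T = [(-1,1), 2/(1+t²)]` and `κ₂` on `(0,1)` with integrand
`f + f`, `f(u) = 1/((1−u)²+u²)`, the substitution `u = (1+t)/2` gives `[T] − [κ₂] ∈ relations`.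
[cite: KontsevichZagier2001, §1.2] -/
theorem arctanRep_sub_double_mem (T κ₂ : IntegralRep 1) (hTd : T.domain = symIoo)
    (hTi : T.integrand = fun x => 2 / (1 + x 0 ^ 2)) (h₂d : κ₂.domain = unitIoo)
    (h₂i : ∀ y, κ₂.integrand y =
      1 / ((1 - y 0) ^ 2 + y 0 ^ 2) + 1 / ((1 - y 0) ^ 2 + y 0 ^ 2)) :
    of T - of κ₂ ∈ relations := by
  refine changeOfVariablesRel_subset_relations
    ⟨1, T, κ₂, halfAffine, fun _ => halfAffineDeriv, ?_,
      fun x _ => (hasFDerivAt_halfAffine x).hasFDerivWithinAt, injective_halfAffine.injOn, ?_,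
      fun x _ => ?_, rfl⟩
  · rw [hTd]
    exact isSemialgebraicMapOn_halfAffine
  · rw [h₂d, hTd, image_halfAffine_symIoo]
  · rw [hTi, h₂i, abs_det_halfAffineDeriv]
    exact (pullback_halfAffine (x 0)).symm

end stub_piCalibrationAux

open stub_piCalibrationAux in
/-- **Calibration of `[π]`**: the disc `[{x²+y² ≤ 1}, 1]` is KZ-equivalent to twice the bounded
arctangent kernel `[[0,1], du/((1−u)²+u²)]` (`∫₀¹ du/((1−u)²+u²) = π/2`): KZ's §1.1 chain
(`stub_piAsArctan`: `[(-1,1), 2/(1+t²)] ∼ [disc, 1]`), the affine substitution `t = 2u − 1`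
(rule 2)), closed versus open interval (null set, rule 1a)) and `[σ, 2f] ≡ 2•[σ, f]` (rule 1b)).
[cite: KontsevichZagier2001, §1.1] -/
theorem stub_piCalibration :
    ∀ (κ : IntegralRep 1), κ.domain = {x | x 0 ∈ Set.Icc (0:ℝ) 1} →
    κ.integrand = (fun x => 1 / ((1 - x 0) ^ 2 + x 0 ^ 2)) →
    of piRep - 2 • of κ ∈ relations := by
  intro κ hd hi
  obtain ⟨T, hTd, hTi⟩ := exists_arctanRep
  obtain ⟨κ₂, κ₀, h₂d, h₂i, h3, h4⟩ := exists_double_open κ hd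
  have h1 : of T - of piRep ∈ relations := arctanRep_equivalent_piRep T hTd hTi
  have h2 : of T - of κ₂ ∈ relations :=
    arctanRep_sub_double_mem T κ₂ hTd hTi h₂d fun y => by rw [h₂i, Pi.add_apply, hi]
  have : of piRep - 2 • of κ = -(of T - of piRep) + (of T - of κ₂) + (of κ₂ - of κ₀ - of κ₀) -
      (of κ - of κ₀) - (of κ - of κ₀) := by
    abel
  rw [this]
  exact relations.sub_mem (relations.sub_mem (relations.add_mem (relations.add_mem
    (relations.neg_mem h1) h2) h3) h4) h4

end Summit.KontsevichZagierPeriods.HurwitzMicroSectors.NormalFormPrinciple.PiBox
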